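import Summits.AtomisticToContinuum.Crystallization.Theorems.OverbindingBudgetHarmonicNormalForm

/-!
# OverbindingBudget — the harmonic bridge in LOCAL-CERTIFICATE NORMAL FORM (decomp-a2c lens-4, generation 42)

Draft node of decomp-a2c lens-4 g42 beneath g41's harmonic normal form
(`…Theorems.OverbindingBudgetHarmonicNormalForm`: K = `HarmonicPolytypeStability`, R = `FineChartStraightening`,
B = `HarmonicReduction ρ₁`, cone `tbdsg_of_harmonic_midAll`; critic rows 616 / 618 / 621 / 623).  Target of record (cone XLVI slot 3):
`TameBalancedDeepScaleGap (122/125) 0 4 (3/50) (1/450)` («TBDSG»).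

## The rock inside B (memo NODE-g42 §2; in-tree verdict N2′).
B's one hard step is CROSS-CHART LOCALISATION: K is a MASSLESS Gårding inequality (`H ≥ λ·S`, `S` = nearest-neighbour bond stretch,
kernel = translations, zero AT `k = 0`), and on in-window finely-deep matter the census has ZERO budget per site, so no lossy cut-off
is admissible.  An IMS partition of unity against `λS` loses `‖h⁺‖·C_d·C_PK/λ_K ≈ 10.7·7.4·0.46/4.5 ≈ 8` per unit of budget even at the
optimal patch radius (scale-free: the Poincaré–Korn gain `r²` of the budget cancels the `r⁻²` of the gradient loss) — the IMS line is
dead (critic row 618 (A)(b)); a quadratic two-scale split needs a wavelength separation `≈ ‖H‖₂/(λ√θ) ≈ 58`, i.e. a dyadic band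
decomposition — LONG (`GardingTransfer` below, ATTACKABLE-L).

## The lens-4 normal form (this file).
Minimal-counterexample reading: a counterexample to bent-reference stability is a bent near-Barlow window on which `H − λS` is
negative; TRANSPLANTING a POINTWISE identity `H − λ'S = Σ_x Σ_m (local square)_{x,m}` from the ideal stacking to the bent window costs
only `O(η)·Σ|δw|²` (chart rotations enter the COEFFICIENTS of squares, never a cut-off; every square annihilates translations, so no
mass term appears), which a certified MARGIN `μ·Σ|δw|²` absorbs pointwise (no Korn inequality on the bent reference).  Hence every counterexample reduces to the NON-EXISTENCE of such an identity, and
existence is ONE FINITE SEMIDEFINITE FEASIBILITY PROBLEM per (scale, word, stencil radius): a Gram matrix `G ⪰ 0` supported on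
radius-`R` stencils with `trace`-constraints matching the Bloch symbol of `H − λ'S − μG` (census instrument I-SOS).  Genuinely UNDECIDED:
on non-chordal interaction graphs PSD does NOT imply «sum of clique-supported PSD» (Agler–Helton–McCullough–Rodman 1988; Grone–
Johnson–Sá–Wolkowicz 1984; [corpus: Zheng–Fantuzzi–Papachristodoulou in Giselsson–Rantzer 2018, Thm 2 p. 52]); the 1-D analogue always
holds (operator Fejér–Riesz); prestress `V′(d) ≠ 0` off `d⋆` makes single-site stars indefinite (rotational geometric stiffness
`∓P|ω|²`), so stencils must exceed the star.  NO tree statement of K-type (UniformTameStability, HarmonicPolytypeStability(Layers),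
TruncatedCensusGapHarmonic*, HarmonicWindowCoercivity) is pointwise/SOS — all are Bloch/PSD-type; the SOS form is what transplants
chart-free.

## Pieces (all `Prop`s over tree declarations; seams PROVED here).
* `LocalHarmonicCertificate R` («K_SOS»; CERT · FINITE-SDP · UNDECIDED) — `H_R − λS − μG_R = Σ squares` with a margin `μ > 0` on the
  radius-`R` pair-difference form `G_R` (`gradForm R`); at `R = 3` STRONGER than K: `harmonicPolytypeStability_of_localCert` PROVED.
* `BentReferenceStability R` («K_bent»; TRUE-type · ATTACKABLE) — `λS_σ + μG_R ≤ H_R` on `η`-charted references; at `R = 3` STRONGER than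
  K: `harmonicPolytypeStability_of_bent` PROVED (identity charts, `bentChart_of_mem_barlowStacking`).
* `CertificateTransplant R` («KT» := K_SOS R → K_bent R; ATTACKABLE-M: pointwise transplant, chart error absorbed by the margin).
* `GardingTransfer R` («KG» := K → K_bent R; ATTACKABLE-L, TRUE-type: two-scale / dyadic Gårding).  `gardingTransfer_of_localCert_transplant`.
* `HarmonicReductionBent R ρ₁` («B″» := K_bent R → R → ∃ ε₁ > 0, fine leaf); WEAKER than B at `R = 3`
  (`harmonicReductionBent_of_harmonicReduction` PROVED) and than the target at every `R` (`harmonicReductionBent_of_target`);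
  B ⟸ KG R ∧ B″ R (`harmonicReduction_of_garding_bent` PROVED).
* Cones XLIX `tbdsg_of_bent_midAll R ρ₁ : K_bent R → R → B″ R ρ₁ → MidAll ρ₁ → TBDSG`, L `tbdsg_of_localCert_midAll R ρ₁ : K_SOS R → KT R →
  R → B″ R ρ₁ → MidAll ρ₁ → TBDSG`, XLIX-K `tbdsg_of_harmonic_garding_midAll`, and the RDEF cones obtained by substitution into cone XLVI
  (`rdef_of_ceg_shape_bent_midAll`, nine slots; `rdef_of_ceg_shape_localCert_midAll`, ten slots).  The truncation radius `R` is a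
  parameter (K-relations at `R = 3`; B″'s tail step may prefer `R = 6…8`, memo §5).
Nothing here proves the summit; rung currency 0.  No `sorry`, no new axioms; statements instance-free and `tsum`-free.
-/

namespace Summit.AtomisticToContinuum.Crystallization.Theorems.OverbindingBudgetLocalHarmonicCertificate

open Filter Metric Set Topology
open scoped BigOperators Classical
open Literature.MathematicalPhysics.StatisticalMechanics
open Literature.Geometry.DiscreteGeometry (IsChargeFree bondGraph nearestDist fccTwoShellPattern hcpTwoShellPattern)
open Summit.AtomisticToContinuum.Crystallization.Theses.OverbindingBudget (RobustDefectLimitWindows)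
open Summit.AtomisticToContinuum.Crystallization.Theses.PricedLinkCensus (ChargedEnergyGap)
open Summit.AtomisticToContinuum.Crystallization.Theorems.OverbindingBudgetGradedBareness (CleanlessExcessT)
open Summit.AtomisticToContinuum.Crystallization.Theorems.OverbindingBudgetCoherentCut (CoherentResidual)
open Summit.AtomisticToContinuum.Crystallization.Theorems.OverbindingBudgetTwoShellShape (TwoShellShape)
open Summit.AtomisticToContinuum.Crystallization.Theorems.OverbindingBudgetBalancedCensusStatements
open Summit.AtomisticToContinuum.Crystallization.Theorems.OverbindingBudgetBalancedCensusRecord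
open Summit.AtomisticToContinuum.Crystallization.Theorems.OverbindingBudgetHarmonicNormalForm

local notation "E3" => EuclideanSpace ℝ (Fin 3)

/-! ## §1  The window forms: K's two sums with a per-site first-shell cutoff, and the margin form -/

/-- **Nearest-neighbour bond-stretch form on a window** `T`, ordered pairs, first-shell cutoff `101/100 · σ x` read at the FIRST site
(`σ` = a local scale field; `σ ≡ a` recovers K's left-hand sum verbatim). [this file] -/
noncomputable def stretchForm (σ : E3 → ℝ) (T : Finset E3) (w : E3 → E3) : ℝ :=
  ∑ x ∈ T, ∑ z ∈ T, if x ≠ z ∧ dist x z ≤ 101 / 100 * σ x then bondStretchSq (z - x) (w z - w x) else 0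

/-- **Radius-`R` truncated Lennard-Jones second variation on a window** `T` (at `R = 3`: K's right-hand sum verbatim).  The truncation
radius is a PARAMETER of this file: the K-relations are at `R = 3`; B″'s tail step may want `R = 6…8` (memo §5 step 6), a literal. [this file] -/
noncomputable def hessForm (R : ℝ) (T : Finset E3) (w : E3 → E3) : ℝ :=
  ∑ x ∈ T, ∑ z ∈ T, if x ≠ z ∧ dist x z ≤ R then ljBondHess (z - x) (w z - w x) else 0

/-- **Radius-`R` pair-difference («gradient») form on a window** `T` — the MARGIN form: a multiple `μ > 0` of it is certified alongside
`λ·stretchForm` in K_SOS and K_bent, so that every later coefficient perturbation (chart rotation errors in KT, cubic remainder and tails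
in B″) is absorbed POINTWISE, with no Korn inequality on bent references (which would itself be a massless transfer problem). [this file] -/
noncomputable def gradForm (R : ℝ) (T : Finset E3) (w : E3 → E3) : ℝ :=
  ∑ x ∈ T, ∑ z ∈ T, if x ≠ z ∧ dist x z ≤ R then ‖w z - w x‖ ^ 2 else 0

/-- The pair-difference form is nonnegative (a sum of nonnegative terms). [this file] -/
theorem gradForm_nonneg (R : ℝ) (T : Finset E3) (w : E3 → E3) : 0 ≤ gradForm R T w :=
  Finset.sum_nonneg fun _ _ => Finset.sum_nonneg fun _ _ => by split_ifs <;> positivity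

/-- K restated through the two window forms (definitional). [this file] -/
theorem harmonicPolytypeStability_iff :
    HarmonicPolytypeStability ↔
      ∃ lam : ℝ, 0 < lam ∧ ∀ (a : ℝ), 19 / 20 ≤ a → a ≤ 1 → ∀ (s : ℤ → ℤ), IsHaggSeq s →
        ∀ (T : Finset E3), (↑T : Set E3) ⊆ barlowStacking a (a * Real.sqrt (2 / 3)) s →
          ∀ (w : E3 → E3), (∀ x, w x ≠ 0 → x ∈ T ∧ ∀ z ∈ barlowStacking a (a * Real.sqrt (2 / 3)) s, dist x z ≤ 3 → z ∈ T) →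
            lam * stretchForm (fun _ => a) T w ≤ hessForm 3 T w :=
  Iff.rfl

/-! ## §2  K_SOS — the LOCAL HARMONIC CERTIFICATE (Gram / sum-of-squares normal form of K) -/

/-- **K_SOS · `LocalHarmonicCertificate`** (CERT · FINITE-SDP · UNDECIDED; the lens-4 normal form).  There are `λ > 0`, a number of squares
`m₀` per centre and a coefficient bound `C_q` such that for every scale `a ∈ [19/20, 1]` and every Hägg word `s` the ideal stacking
`barlowStacking a (a√(2/3)) s` carries a family of VIRTUAL-FORCE STENCILS `c x m : E3 → E3` (centre `x`, index `m < m₀`) which are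
(i) LOCAL — supported on stacking sites within `3` of the centre, itself a stacking site; (ii) BOUNDED by `C_q`; (iii) SELF-EQUILIBRATED —
`Σ_z c x m z = 0` (each square annihilates translations: no mass term, the reason the certificate transplants to bent references); and
(iv) CERTIFY K POINTWISE WITH A MARGIN `μ > 0`: on every admissible window (`T ⊇` the radius-3 stacking neighbourhood of `supp w`,
exactly K's hypothesis) `hessForm T w − λ·stretchForm a T w − μ·gradForm T w = Σ_{x ∈ T} Σ_{m < m₀} (Σ_{z ∈ T} ⟪c x m z, w z⟫)²`
(room for `μ`: on the lattice `H − λ'S ≥ (λ_K − λ')S ≥ ((λ_K − λ')/C_G)·G` by the Bloch comparison of the two translation-invariant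
forms `S`, `G` with common kernel = translations, `C_G < ∞`).
Because a stencil reaches only radius `3` from its centre, every square that sees `supp w` is centred in `T`, so (iv) is the honest
finite-window rendering of «`H − λS` is a locally finite sum of squares of local linear functionals».  EXISTENCE = feasibility of one
semidefinite program per `(a, s)`: Gram matrix `G(a,s) ⪰ 0` on the radius-3 stencil space, linear constraints = coefficient matching
with the Bloch symbol `Ĥ(k) − λ'Ŝ(k)` (fcc `3 × 3`, hcp `6 × 6`, word-local blocks for general `s`); instrument I-SOS (memo §4: try
`λ' ∈ {2, 3, 4}` below `inf λ = 4.52` of census TAG 193, stencil radii `√2·a, √3·a, 2a, 3`; < 1 core-h).  WHY IT MIGHT FAIL: the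
interaction graph is not chordal, and PSD ⇏ clique-SOS there (Agler–Helton–McCullough–Rodman 1988); prestress off `d⋆` forbids
single-star stencils.  In-plane translation covariance and Lipschitz dependence on `a` are NOT demanded (averaging over the layer
lattice restores the first; I-SOS is asked for STRICTLY feasible certificates so that interpolation in `a` gives the second).
[lens-4 g42; Dumitrescu 2007 (Gram-matrix parametrisation of positive trigonometric matrix polynomials) [galaxy:pdf:5122316900];
Giselsson–Rantzer (eds.) 2018 ch. 3 Thm 2 (Agler) [corpus p. 52]; Hudson–Ortner 2012 (lattice stability, shape)] -/
def LocalHarmonicCertificate (R : ℝ) : Prop :=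
  ∃ lam : ℝ, 0 < lam ∧ ∃ μ : ℝ, 0 < μ ∧ ∃ (m₀ : ℕ) (Cq : ℝ), ∀ (a : ℝ), 19 / 20 ≤ a → a ≤ 1 → ∀ (s : ℤ → ℤ), IsHaggSeq s →
    ∃ c : E3 → ℕ → E3 → E3,
      (∀ x m z, c x m z ≠ 0 →
          m < m₀ ∧ x ∈ barlowStacking a (a * Real.sqrt (2 / 3)) s ∧ z ∈ barlowStacking a (a * Real.sqrt (2 / 3)) s ∧
            dist x z ≤ R) ∧
      (∀ x m z, ‖c x m z‖ ≤ Cq) ∧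
      (∀ x m (Z : Finset E3), (∀ z, c x m z ≠ 0 → z ∈ Z) → ∑ z ∈ Z, c x m z = 0) ∧
      ∀ (T : Finset E3), (↑T : Set E3) ⊆ barlowStacking a (a * Real.sqrt (2 / 3)) s →
        ∀ (w : E3 → E3), (∀ x, w x ≠ 0 → x ∈ T ∧ ∀ z ∈ barlowStacking a (a * Real.sqrt (2 / 3)) s, dist x z ≤ R → z ∈ T) →
          hessForm R T w - lam * stretchForm (fun _ => a) T w - μ * gradForm R T w
            = ∑ x ∈ T, ∑ m ∈ Finset.range m₀, (∑ z ∈ T, inner ℝ (c x m z) (w z)) ^ 2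

/-- **K_SOS 3 ⇒ K** (a sum of squares is non-negative): the radius-3 certificate is on the STRONGER side of `HarmonicPolytypeStability`.
[this file] -/
theorem harmonicPolytypeStability_of_localCert (h : LocalHarmonicCertificate 3) : HarmonicPolytypeStability := by
  obtain ⟨lam, hlam, μ, hμ, m₀, Cq, h⟩ := h
  refine ⟨lam, hlam, fun a ha ha' s hs T hT w hw => ?_⟩
  obtain ⟨c, -, -, -, hid⟩ := h a ha ha' s hs
  have hsq : 0 ≤ ∑ x ∈ T, ∑ m ∈ Finset.range m₀, (∑ z ∈ T, inner ℝ (c x m z) (w z)) ^ 2 :=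
    Finset.sum_nonneg fun x _ => Finset.sum_nonneg fun m _ => sq_nonneg _
  have hG : 0 ≤ μ * gradForm 3 T w := mul_nonneg hμ.le (gradForm_nonneg 3 T w)
  have := hid T hT w hw
  show lam * stretchForm (fun _ => a) T w ≤ hessForm 3 T w
  linarith

/-! ## §3  K_bent — BENT-REFERENCE STABILITY (the statement both fillers aim at) -/

/-- **A similarity chart at gradient tolerance `η`, radius `R + 1`.**  The site `x` of the reference set `Z` sees, within `R + 1`, exactly
the image of an ideal stacking `barlowStacking (σ x) (σ x·√(2/3)) s` (`IsHaggSeq s`, scale `σ x ∈ [19/20, 1]`) under `p ↦ x + A(p − x₀)`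
(`A` a linear isometry, `x₀` a stacking site) up to a RELATIVE error `η·dist p x₀` — exact at the centre, `≤ (R+1)η` at the rim (preimages
are sought within `R + 2`, so that rim sites whose preimage lies just beyond `R + 1` are not excluded): the chart
controls positions to first order in the distance (a bent, not a jittered, crystal).  Identity charts: `Z` an ideal stacking, `σ ≡ a`,
`x₀ = x`, `A = id`, error `0`. [this file] -/
def BentChart (η R : ℝ) (Z : Set E3) (σ : E3 → ℝ) (x : E3) : Prop :=
  19 / 20 ≤ σ x ∧ σ x ≤ 1 ∧ ∃ s : ℤ → ℤ, IsHaggSeq s ∧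
    ∃ x₀ ∈ barlowStacking (σ x) (σ x * Real.sqrt (2 / 3)) s, ∃ A : E3 →ₗᵢ[ℝ] E3,
      (∀ p ∈ barlowStacking (σ x) (σ x * Real.sqrt (2 / 3)) s, dist p x₀ ≤ R + 1 →
          ∃ q ∈ Z, dist q (x + A (p - x₀)) ≤ η * dist p x₀) ∧
      (∀ q ∈ Z, dist q x ≤ R + 1 →
          ∃ p ∈ barlowStacking (σ x) (σ x * Real.sqrt (2 / 3)) s, dist p x₀ ≤ R + 2 ∧ dist q (x + A (p - x₀)) ≤ η * dist p x₀)

/-- **K_bent · `BentReferenceStability R`** (TRUE-type · ATTACKABLE; the common target of KT and KG).  There are `η, λ, μ > 0` such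
that for every reference set `Z`, scale field `σ` and window `T ⊆ Z` all of whose sites carry an `η`-chart of radius `R + 1` (any word,
any scale in `[19/20, 1]`, per site), and every displacement field `w` whose support together with its radius-`R` `Z`-neighbourhood lies
in `T`: `λ · stretchForm σ T w + μ · gradForm R T w ≤ hessForm R T w` (the `μ`-margin absorbs B″'s cubic remainder and tails pointwise).
This is exactly what B's second-order step consumes on the straightened reference of R over a fine-deep region (charts from
registration at gradient tolerance `η ≍ C ρ² ε₁`; the edge of the region is NOT chartable, so `w` is cut there — through rebated,
not-finely-deep sites only, memo §5).  WHY IT MIGHT FAIL: only through `η` — strain GRADIENTS of size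
`η` per site are allowed, and positivity must survive coefficient errors `O(η‖H′‖)` (`‖H′‖ ≈ |V‴(d⋆)| ≈ 209` ⇒ `η ≲ 5·10⁻³`); the
statement carries `∃ η`. [lens-4 g42; E–Ming 2007, Ortner–Theil 2013 (stability of smoothly deformed lattices, shape);
Conti–Dolzmann–Kirchheim–Müller 2006 (Cauchy–Born near SO(3))] -/
def BentReferenceStability (R : ℝ) : Prop :=
  ∃ η : ℝ, 0 < η ∧ ∃ lam : ℝ, 0 < lam ∧ ∃ μ : ℝ, 0 < μ ∧ ∀ (Z : Set E3) (σ : E3 → ℝ) (T : Finset E3), (↑T : Set E3) ⊆ Z →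
    (∀ x ∈ T, BentChart η R Z σ x) →
      ∀ (w : E3 → E3), (∀ x, w x ≠ 0 → x ∈ T ∧ ∀ z ∈ Z, dist x z ≤ R → z ∈ T) →
        lam * stretchForm σ T w + μ * gradForm R T w ≤ hessForm R T w

/-- Identity charts: every site of an ideal stacking at scale `a ∈ [19/20, 1]` carries an `η`-chart of every radius, every `η ≥ 0`.
[this file] -/
theorem bentChart_of_mem_barlowStacking {η a : ℝ} (R : ℝ) (hη : 0 ≤ η) (ha : 19 / 20 ≤ a) (ha' : a ≤ 1) {s : ℤ → ℤ}
    (hs : IsHaggSeq s) {x : E3} (hx : x ∈ barlowStacking a (a * Real.sqrt (2 / 3)) s) :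
    BentChart η R (barlowStacking a (a * Real.sqrt (2 / 3)) s) (fun _ => a) x := by
  refine ⟨ha, ha', s, hs, x, hx, (LinearIsometry.id : E3 →ₗᵢ[ℝ] E3), ?_, ?_⟩
  · intro p hp _
    refine ⟨p, hp, ?_⟩
    have : x + (LinearIsometry.id : E3 →ₗᵢ[ℝ] E3) (p - x) = p := by simp
    rw [this, dist_self]
    exact mul_nonneg hη dist_nonneg
  · intro q hq hqx
    refine ⟨q, hq, ?_, ?_⟩
    · linarith [hqx]
    · have : x + (LinearIsometry.id : E3 →ₗᵢ[ℝ] E3) (q - x) = q := by simp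
      rw [this, dist_self]
      exact mul_nonneg hη dist_nonneg

/-- **K_bent 3 ⇒ K** (identity charts): radius-3 bent-reference stability is on the STRONGER side of `HarmonicPolytypeStability`.
[this file] -/
theorem harmonicPolytypeStability_of_bent (h : BentReferenceStability 3) : HarmonicPolytypeStability := by
  obtain ⟨η, hη, lam, hlam, μ, hμ, h⟩ := h
  refine ⟨lam, hlam, fun a ha ha' s hs T hT w hw => ?_⟩
  have hG : 0 ≤ μ * gradForm 3 T w := mul_nonneg hμ.le (gradForm_nonneg 3 T w)
  have := h _ (fun _ => a) T hT (fun x hx => bentChart_of_mem_barlowStacking 3 hη.le ha ha' hs (hT hx)) w hw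
  show lam * stretchForm (fun _ => a) T w ≤ hessForm 3 T w
  linarith

/-! ## §4  The two fillers of K_bent and the weakened bridge -/

/-- **KT · `CertificateTransplant R`** := K_SOS R → K_bent R (ATTACKABLE-M; the lens-4 line).  Mechanism (memo §3): at a charted site `x` of
`Z` put `q_x(w) := Σ_m (Σ_ℓ ⟪A_x c_{m,ℓ}, w(φ_x ℓ)⟫)² ≥ 0` (the lattice stencil carried by the chart); expand `hessForm_Z − Σ_x q_x −
λ'·stretchForm`: on the ideal stacking it vanishes identically by (iv); on `Z` every bond term and every stencil coefficient is within
`O(η·radius)` of its charted value (`|∂ ljBondHess| ≤ ‖H′‖ ≈ 209`), neighbouring charts agree to `O(η)` modulo a stacking symmetry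
(they fit ≥ 30 common sites), and all pieces annihilate translations, so the defect is `≤ C_T·η·gradForm T w` with a NUMBER `C_T` fixed by
the certificate (`≈ m₀ C_q² · #stencil · 6 + 6‖H′‖`); it is absorbed by HALF THE MARGIN: `η ≤ μ/(2 C_T)` gives K_bent with `(λ', μ/2)` — no
Korn inequality on the bent reference is needed (that would itself be a massless transfer problem).  Scale drift across the
window: certificates on a grid of scales (spacing `≍ μ/‖∂_a H‖`) glued along switching surfaces by the null-decomposition flux (two
local decompositions of one lattice form differ by a local divergence), or a Lipschitz-in-`a` certificate family (memo §3).
WHY IT MIGHT FAIL: only if K_SOS fails (then KT is vacuous and KG is the filler). [lens-4 g42] -/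
def CertificateTransplant (R : ℝ) : Prop :=
  LocalHarmonicCertificate R → BentReferenceStability R

/-- **KG · `GardingTransfer R`** := K → K_bent R (ATTACKABLE-L · TRUE-type; the classical filler).  Two-scale scheme (memo §3′): freeze
charts on mesoscopic cells of radius `r_K`, split `w = w_s + w_r` at an intermediate scale `r_ξ ∈ [r₀, r_K/4]` — the smooth part is
paid by cell-wise Cauchy–Born with Taylor error `(a/r_ξ)²`, the rough part is localised by IMS at radius `r_ξ` with the loss now
measured against `r_K` (gain `(r_ξ/r_K)²` over the dead one-scale IMS); the quadratic cross term forces a dyadic band decomposition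
(adjacent-band coupling `≈ ‖H‖₂/(λ√θ) ≈ 58` per octave is too large for two bands).  Long but standard (Gårding 1953 with frozen
coefficients; E–Ming 2007 §§4–5). [lens-4 g42] -/
def GardingTransfer (R : ℝ) : Prop :=
  HarmonicPolytypeStability → BentReferenceStability R

/-- **B″ · `HarmonicReductionBent R ρ₁`** := K_bent R → R(straightening) → ∃ ε₁ > 0, `TameBalancedDeepScaleGap (122/125) 0 ρ₁ ε₁ (1/450)` (ATTACKABLE-L
minus the localisation step; WEAKER than B).  What remains (memo §3, budgets): zeroth order by the equation of state `e_P(a)` of the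
charted polytype (convex on `[19/20, 1]`, Jensen over the slowly varying scale; priced sites earn `e_iso ≈ 6.7·10⁻³`), first order =
boundary flux through rebated sites + the polytype axial force completed to a square (critic row 616 R2), second order = K_bent on the
straightened reference of R with `η = C ρ₁² ε₁·(const)`, cubic remainder `≤ 70·|v|·Σ|δv|²` absorbed for `ε₁ ≤ ε₀(ρ₁)`; `ρ₁` is free
(`MidAll ρ₁` for every `ρ₁ ≥ 4`) and `ε₁` is OURS (`∃ ε₁`). [lens-4 g42] -/
def HarmonicReductionBent (R ρ₁ : ℝ) : Prop :=
  BentReferenceStability R → FineChartStraightening →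
    ∃ ε₁ : ℝ, 0 < ε₁ ∧ TameBalancedDeepScaleGap (122 / 125) 0 ρ₁ ε₁ (1 / 450)

/-- **B ⇒ B″ 3**: the radius-3 bent bridge is on the WEAKER side of g41's bridge. [this file] -/
theorem harmonicReductionBent_of_harmonicReduction {ρ₁ : ℝ} (hB : HarmonicReduction ρ₁) : HarmonicReductionBent 3 ρ₁ :=
  fun hKb hR => hB (harmonicPolytypeStability_of_bent hKb) hR

/-- B″ is implied by the target of record for every `R` and every `ρ₁ ≥ 4` (witness `ε₁ = 3/50`). [this file] -/
theorem harmonicReductionBent_of_target (R : ℝ) {ρ₁ : ℝ} (hρ : 4 ≤ ρ₁)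
    (h : TameBalancedDeepScaleGap (122 / 125) 0 4 (3 / 50) (1 / 450)) : HarmonicReductionBent R ρ₁ :=
  fun _ _ => ⟨3 / 50, by norm_num, fine_of_target le_rfl hρ h⟩

/-- **B ⟸ KG R ∧ B″ R** (the g42 split of g41's bridge, at any truncation radius; seam PROVED). [this file] -/
theorem harmonicReduction_of_garding_bent {R ρ₁ : ℝ} (hG : GardingTransfer R) (hB : HarmonicReductionBent R ρ₁) :
    HarmonicReduction ρ₁ :=
  fun hK hR => hB (hG hK) hR

/-- **KG ⟸ K_SOS ∧ KT** (the certificate line fills the Gårding slot outright). [this file] -/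
theorem gardingTransfer_of_localCert_transplant {R : ℝ} (hS : LocalHarmonicCertificate R) (hT : CertificateTransplant R) :
    GardingTransfer R :=
  fun _ => hT hS

/-- **K_bent ⟸ K_SOS ∧ KT** (modus ponens, recorded for the cone). [this file] -/
theorem bentReferenceStability_of_localCert_transplant {R : ℝ} (hS : LocalHarmonicCertificate R) (hT : CertificateTransplant R) :
    BentReferenceStability R :=
  hT hS

/-! ## §5  CONES (PROVED compositions) -/

/-- **CONE XLIX (slot 3 in bent normal form).** `K_bent R → R → B″ R ρ₁ → MidAll ρ₁ → TameBalancedDeepScaleGap (122/125) 0 4 (3/50) (1/450)`.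
[this file] -/
theorem tbdsg_of_bent_midAll (R ρ₁ : ℝ) (hKb : BentReferenceStability R) (hR : FineChartStraightening)
    (hB : HarmonicReductionBent R ρ₁) (hM : MidAll ρ₁) : TameBalancedDeepScaleGap (122 / 125) 0 4 (3 / 50) (1 / 450) := by
  obtain ⟨ε₁, hε₁, hF⟩ := hB hKb hR
  have hF' : TameBalancedDeepScaleGap (122 / 125) 0 ρ₁ (min ε₁ (3 / 50)) (1 / 450) :=
    tameBalancedDeepScaleGap_anti_tol (min_le_left _ _) hF
  exact tameBalancedDeepScaleGap_of_fine_mid hF' (hM _ (lt_min hε₁ (by norm_num)) (min_le_right _ _))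

/-- **CONE L (slot 3 in local-certificate normal form).** `K_SOS R → KT R → R → B″ R ρ₁ → MidAll ρ₁ → TBDSG`. [this file] -/
theorem tbdsg_of_localCert_midAll (R ρ₁ : ℝ) (hS : LocalHarmonicCertificate R) (hT : CertificateTransplant R)
    (hR : FineChartStraightening) (hB : HarmonicReductionBent R ρ₁) (hM : MidAll ρ₁) :
    TameBalancedDeepScaleGap (122 / 125) 0 4 (3 / 50) (1 / 450) :=
  tbdsg_of_bent_midAll R ρ₁ (hT hS) hR hB hM

/-- **CONE XLIX-K (slot 3, Gårding filler).** `K → KG R → R → B″ R ρ₁ → MidAll ρ₁ → TBDSG` — g41's cone with B split as KG ∧ B″.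
[this file] -/
theorem tbdsg_of_harmonic_garding_midAll (R ρ₁ : ℝ) (hK : HarmonicPolytypeStability) (hG : GardingTransfer R)
    (hR : FineChartStraightening) (hB : HarmonicReductionBent R ρ₁) (hM : MidAll ρ₁) :
    TameBalancedDeepScaleGap (122 / 125) 0 4 (3 / 50) (1 / 450) :=
  tbdsg_of_harmonic_midAll ρ₁ hK hR (harmonicReduction_of_garding_bent hG hB) hM

/-- **RDEF CONE XLIX (record, nine slots)** — cone XLVI with slot 3 in bent normal form:
`ChargedEnergyGap → TwoShellShape (1/100) (3/50) (1/450) → K_bent R → R → B″ R ρ₁ → MidAll ρ₁ → CleanlessExcessT → CoherentResidual 10 →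
RobustDefectLimitWindows`. [this file] -/
theorem rdef_of_ceg_shape_bent_midAll (R ρ₁ : ℝ) (hCEG : ChargedEnergyGap) (hT : TwoShellShape (1 / 100) (3 / 50) (1 / 450))
    (hKb : BentReferenceStability R) (hR : FineChartStraightening) (hB : HarmonicReductionBent R ρ₁) (hM : MidAll ρ₁)
    (hCE : CleanlessExcessT) (hRes : CoherentResidual 10) : RobustDefectLimitWindows :=
  rdef_of_ceg_shape_balancedDeep_record hCEG hT (tbdsg_of_bent_midAll R ρ₁ hKb hR hB hM) hCE hRes

/-- **RDEF CONE L (record, ten slots)** — cone XLVI with slot 3 in local-certificate normal form: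
`ChargedEnergyGap → TwoShellShape (1/100) (3/50) (1/450) → K_SOS R → KT R → R → B″ R ρ₁ → MidAll ρ₁ → CleanlessExcessT →
CoherentResidual 10 → RobustDefectLimitWindows`. [this file] -/
theorem rdef_of_ceg_shape_localCert_midAll (R ρ₁ : ℝ) (hCEG : ChargedEnergyGap) (hT : TwoShellShape (1 / 100) (3 / 50) (1 / 450))
    (hS : LocalHarmonicCertificate R) (hKT : CertificateTransplant R) (hR : FineChartStraightening)
    (hB : HarmonicReductionBent R ρ₁) (hM : MidAll ρ₁) (hCE : CleanlessExcessT) (hRes : CoherentResidual 10) :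
    RobustDefectLimitWindows :=
  rdef_of_ceg_shape_balancedDeep_record hCEG hT (tbdsg_of_localCert_midAll R ρ₁ hS hKT hR hB hM) hCE hRes

end Summit.AtomisticToContinuum.Crystallization.Theorems.OverbindingBudgetLocalHarmonicCertificate
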